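import Literature.MathematicalPhysics.QuantumFieldTheory.Balaban1983to89.B9Eq387CubeReductionGaugeBackground
import Literature.MathematicalPhysics.QuantumFieldTheory.Balaban1983to89.B9Eq335SmallPlaquettesLocalData
import Literature.MathematicalPhysics.QuantumFieldTheory.Balaban1983to89.B9Eq387CubeReductionSmallField
import Literature.MathematicalPhysics.QuantumFieldTheory.Balaban1983to89.B9Eq387CubeProjectionLocality
import Literature.MathematicalPhysics.QuantumFieldTheory.Balaban1983to89.B9Eq315QTorusLocality
import Literature.MathematicalPhysics.QuantumFieldTheory.Balaban1983to89.B9Eq389CubeLocalisedProjectionWindowAdjoint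
import Literature.MathematicalPhysics.QuantumFieldTheory.Balaban1983to89.B9Thm311SmallFieldClosedUniform
import Literature.MathematicalPhysics.QuantumFieldTheory.Balaban1983to89.B9Eq335SmallBondsData
import Literature.MathematicalPhysics.QuantumFieldTheory.Balaban1983to89.B9Eq3100LeibnizCommutatorDiv
import Literature.MathematicalPhysics.QuantumFieldTheory.Balaban1983to89.B9Eq387CubeReductionGeometry

/-!
# `Balaban1983to89.B9Eq387CubeReductionClosed` — T. Bałaban, *Propagators for lattice gauge theories in a background field*, Commun. Math. Phys. **99**
# (1985) 389–434 [Balaban1985BackgroundPropagators] (3.35) p. 396, Cor. 3.6 p. 408 («If a configuration U satisfies (3.35) … then Theorems 3.1–3.3 hold for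
# the operators G′_□(U), …»), Thm 3.11 p. 416 and its gauge step («Doing the gauge transformation we get the configuration U = e^{iηA} with A small»),
# (3.87)–(3.89) p. 409, (3.26) p. 395: **ROW L10's CUBE-LOCALISED COERCIVITY (loc) FOR A BACKGROUND OF THE (3.35) CLASS — small PLAQUETTES, bond
# variables NOT near `1` — AS A CLOSED THEOREM UP TO DISPLAYED SCALAR WINDOWS: the per-cube gauge reduction of ne9-leaf-06's
# `B9Eq387CubeReductionSmallField` with EVERY ONE of its twenty letters inhabited BY NAME** — route R2′ STEP B8′, instance-ledger row L10 «per-cube ε ↔ α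
# junction» of the pub-balaban NE9 chain (`t4/ROUTES-NE9.md` v13.46); the junction certified as J-K10 (cell journal [NE9LEAF05-G79-JK10])

statement-level skeleton of published theorems with citation tags; proofs where landed; nothing here is a claim about the Yang–Mills mass gap

CITATION HEADER (lean-in-tree rule).  Audit cell `pub-balaban`, sub-cell `t4`, BINDER row NE9; filed by NE9 formalisation-swarm LEAF PROVER 05
(`b2b-balaban-t4-ne9-formalise-leaf-05`, gen 79).  A COMPOSITION BY NAME of: ne9-leaf-06's `B9Eq387CubeReductionSmallField.cube_estimate_of_gauge_reduction`
(the reduction, all letters displayed) and `B9Thm311SmallFieldClosedUniform.exists_coercive_principal_of_small_field_uniform₀` ([B9] Thm 3.11's principal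
coercivity, volume-uniform); this lineage's `B9Eq387CubeReductionGaugeBackground.exists_gauge_background_coarseCube` (the pair `(g, Ũ)`),
`B9Eq335SmallPlaquettesLocalData` (`U`'s `Q`-data from plaquettes), `B9Eq389CubeLocalisedProjectionWindowAdjoint.exists_window_hcmp` ((β), `∃`-first),
`B9Eq387CubeProjectionLocality` ((K8): `hlocR ∕ hlocD ∕ hlocC`), `B9Eq315QTorusLocality.norm_QtorusW_gauge_transfer` ((K8-Q): `hQ`); the tree's
`B9Eq335SmallBondsData` (`Ũ`'s `Q`-data), `B9Eq3100LeibnizCommutatorDiv.norm_covDivL2K_le_of_transport` (`hMD`), `B9Eq333ProjectionCovariance.hreg_gaugeU`,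
`B7Eq44TorusAxialGauge.gaugeU_mem_U1`.  Source READ in the held text [Balaban1985BackgroundPropagators] (journal page = PDF page + 388): p. 396 (3.35), p. 408
Cor. 3.6, p. 409 (3.87)–(3.89), p. 416 Thm 3.11; [Balaban1985Averaging] pp. 24–25.  NOTHING of print's constants is asserted: the windows are DISPLAYED.

WHY (row L10).  Kernel 7's (loc) asks, per partition cube, a coercivity estimate of the (3.26) form AT the given background `U`; for the (3.35) class [B9]
Thm 3.11 does not apply to `U` (bonds not small) — print gauges each cube (Cor. 3.6 ∕ Thm 3.11's proof).  Every ingredient of that sentence is in the tree or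
staged by name; this file is their junction, with the analytic residue printed as scalar windows: SC's smallness window at the auxiliary background, the
regularity threshold, (β)'s window, and the collar number `3ε_E(κ, C, r₀, R)·M_D² ≤ γ∕2` (`M_D² = 16(d+1)L²` at `ηL = 1`, level-free).

WHAT IS PROVED (sorry-free; proof lane — no `def`, no `Prop` placeholder; [folklore]).
* §1 (moved to `B9Eq387CubeReductionGeometry`, imported): the radius-`r` torus geometry `liftSite_sub_mem_of_tdist_le` (the `r`-ball of a boxed set is boxed).
* §2 **`cube_loc_closed`** — see its docstring: `(γ∕2)‖A‖² ≤ ‖curl_U A‖² + ‖R(U)(D*_U A)‖² + ‖√a·Q_U A‖²` for cube fields over `Z₀`, under (W1)–(W3);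
  = ne9-leaf-01's `B9Eq387IMSLocShapeAdapter.loc_shape_of_cubeForm`'s hypothesis `h` at `γ₁ := 0`, `γ₀ := γ∕2` (kernel 7's `_hloc` one adapter away).
MODEL ∕ DECLARED READINGS.  (M1) dimension `d+1` (the (β) window's indexing); the chain's encodings verbatim; (M2) the (3.35) class read as: `U(b) ∈ U1`,
unitary, ALL plaquettes `δ`-close (one level, small field everywhere; large-field regions are another chapter); (M3) the cube datum = support blocks `Z₀`
inside a coarse box with collar `r₀ + R + 1` on each side, the box's extent `Nc` with `Nc + 4 ≤ m` (no wrap); (M4) `hAdU` displayed (supplier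
`B9Eq328GaugeAction.inner_AdW_AdW_of_compat`).  NOT HERE (HONEST RESIDUE): the ADMISSIBILITY of the windows — that `δ ≤ δ₀(d, L, a, M_φ, M_φ′, c₀, c₁, Nc)` and
`r₀, R ≥ ρ₀(…)` make (W1)–(W3) hold (`ε_E = A·e^{−κr₀∕2} + B∕R` with `A, B` free of `r₀, R`: elementary — the Mathlib-only sequel
`B9Eq387CubeReductionClosedWindows.windows_admissible`, `∃ r₀ R` before `Nc`, `∃ δ₀ > 0` after); the NUMBERS `γ`, `ε₂`, `ε₁`, `κ`, `C`
themselves (the suppliers' `∃`); Tier P ∕ row L11 (ne9-leaf-01's assembly consumes this per partition member); anything at the next level.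
HONEST SCOPE.  A junction BY NAME; NOT Tier P, NOT NE9 (cell pub-balaban: NE9 NOT PRINTED ∕ NOT PROVED; «NE9 ⇐ the named binders»; row WALLED ON A MODEL
(O-NE9-1; #5 UNRULED); spine PROVED 0∕9; rung (B)+1 on a finite T⁴ — NOT infinite volume, NOT mass gap, NOT BetaPertH, NOT Clay; HONEST DEPENDENCY: continuum
YM on T⁴ ⇐ BetaPertH ∧ nine spine estimates (0/9 proved); BetaPertH ⇐ (D1) ∧ (D4) ∧ CAP+tail; G-an2-4 gates asym, D1 and NE2/3/4).  NEW file; nothing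
modified.  Net new unproved facts: 0.
-/

noncomputable section

set_option autoImplicit false

open scoped InnerProductSpace

namespace Literature.MathematicalPhysics.QuantumFieldTheory.Balaban1983to89.B9Eq387CubeReductionClosed

open B4TorusKernel.MultiPeriod (circAbs)
open B4Sect5Torus (TSite tdist circAbs_le_tdist tdist_triangle tdist_self tdist_nonneg tdist_symm)
open B9SectCLatticeCarrier (Bond bpos unshift)
open B7Prop1Explicit (e l1 U1 Wcx boxVec)
open B9Eq315QTorus (perCfg cornerSite QtorusW)
open B9Eq315QTorusOnto (liftSite)
open B9Eq310DeltaPrime (plaqHolU)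
open B9Eq311L2Pairing (WL2)
open B11Eq103H1Complex (SiteL2K BondL2K covDerivL2K covDivL2K covLaplaceSiteK laplaceALatticeK projR)
open B9Eq310HessianOperator (adTransportW principalOpK covCurlL2K)
open B9Eq326OperatorAssembly (QprimeW RofU)
open B9Eq328GaugeAction (gaugeU gaugeW AdW equiv_gaugeW_eq)
open B9Eq319QprimeTorus (fineP blockCoord centre)
open B5Eq172FlatCoercivity (hU1_one hreg_one)
open B9Eq335SmallBondsData (perCfg_mem_U1 hreg_of_small_bonds alpha_le_64 epsReg_pos)
open B9Eq335SmallPlaquettesLocalData (hreg_of_small_plaquettes_local' alpha_le_64_of_le)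
open B9Thm311SmallFieldClosedUniform (exists_coercive_principal_of_small_field_uniform₀)
open B9Eq389CubeLocalisedProjectionWindowAdjoint (exists_window_hcmp)
open B9Eq387CubeReductionGaugeBackground (exists_gauge_background_coarseCube)
open B9Eq387CubeReductionSmallField (cube_estimate_of_gauge_reduction)
open B9Eq387CubeReductionGeometry (liftSite_sub_mem_of_tdist_le)
open B9Eq387CubeProjectionLocality (cube_projR_congr_of_background covDivL2K_congr covCurlL2K_congr_of_support adTransportW_congr
  adTransportW_inv_congr)
open B9Eq315QTorusLocality (norm_QtorusW_gauge_transfer)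
open B9Eq3100LeibnizCommutatorDiv (norm_covDivL2K_le_of_transport)
open B9Eq333ProjectionCovariance (hreg_gaugeU)
open B7Eq44TorusAxialGauge (gaugeU_mem_U1)
open B4Sect5Proof (latticeConst)

variable {d : ℕ}

/-! ## §1 (moved) The torus geometry — `exists_step_of_circAbs_le`, `exists_step_of_tdist_le`, `liftSite_sub_mem_of_tdist_le` — now lives in
`B9Eq387CubeReductionGeometry` (imported), together with the cube-placement letter for Tier P. -/

/-! ## §2 The CLOSED per-cube (loc) estimate for the (3.35) class, scalar windows displayed -/

variable (L : ℕ) [NeZero L] (hL : 3 ≤ L)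
  {𝔸 : Type*} [NormedRing 𝔸] [NormedAlgebra ℂ 𝔸] [CompleteSpace 𝔸] [NormOneClass 𝔸] [StarMul 𝔸]
  {W : Type*} [NormedAddCommGroup W] [InnerProductSpace ℂ W] [FiniteDimensional ℂ W] (φ : W ≃ₗ[ℂ] 𝔸) {Mφ Mφ' : ℝ}
  (hφ : ∀ w, ‖φ w‖ ≤ Mφ * ‖w‖) (hφ' : ∀ X, ‖φ.symm X‖ ≤ Mφ' * ‖X‖) (hMφ : 0 ≤ Mφ) (hMφ' : 0 ≤ Mφ')
  (c₀ : ℝ) [Fact (0 < c₀)] (η : ℝ) (hη : 0 < η) (c₁ : ℝ) [Fact (0 < c₁)] (hc : c₁ = (L : ℝ) ^ (d + 1) * c₀) (hηL : η * L = 1)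
  {a : ℝ} (ha : 0 < a)
  (hAdU : ∀ u : 𝔸ˣ, star ((u : 𝔸ˣ) : 𝔸) = ((u⁻¹ : 𝔸ˣ) : 𝔸) → ∀ v v' : W, ⟪AdW φ u v, AdW φ u v'⟫_ℂ = ⟪v, v'⟫_ℂ)

include hL hφ hφ' hMφ hMφ' hη hc hηL ha hAdU in
/-- **ROW L10's (loc) FOR THE (3.35) CLASS, CLOSED UP TO DISPLAYED SCALAR WINDOWS.**  `∃ γ ε₂ ε₁ κ C` BEFORE the volume (`γ, ε₂` = [B9] Thm 3.11's
principal coercivity `B9Thm311SmallFieldClosedUniform.exists_coercive_principal_of_small_field_uniform₀`; `ε₁ κ C` = the (β) window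
`B9Eq389CubeLocalisedProjectionWindowAdjoint.exists_window_hcmp`) such that for EVERY volume `m`, EVERY unit-bounded UNITARY background
`U` whose plaquette variables are ALL `δ`-close to `1` (`0 ≤ δ ≤ 1∕(64(L·d(L−1)+1))` — small plaquettes, bond variables NOT near `1`), EVERY cube datum
(collar radii `r₀, R ∈ ℕ_{>0}`, extent `Nc` with `Nc_i + 4 ≤ m_i`, corner `y₁`, support blocks `Z₀ ⊆ y₁ + [r₀+R+1, Nc+1−(r₀+R)]`) and EVERY bond field
`A` supported over `Z₀`'s blocks, under the DISPLAYED SCALAR WINDOWS (W1) `ε̃ ≤ ε₂`, (W1′) `ε̃ ≤ ε_reg(d+1, L)`, (W2) `ε̃ ≤ ε₁` (`ε̃ := |L(Nc+3)|₁·δ`, the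
smallness of the auxiliary background) and (W3) `ε_E ≤ 1`, `3ε_EM_D² ≤ γ∕2` (`ε_E` = the (β) window's printed expression at `β₂ := 2ε̃`,
`M_D = 2√(d+1)‖η⁻¹‖·2`):  `(γ∕2)‖A‖² ≤ ‖curl_U A‖² + ‖R(U)(D*_U A)‖² + ‖√a·Q_U A‖²`, `Q_U = QtorusW … U …` at `U`'s own data (small plaquettes,
`B9Eq335SmallPlaquettesLocalData`).  PROOF: `B9Eq387CubeReductionGeometry.liftSite_sub_mem_of_tdist_le` places the collar set in the box; `B9Eq387CubeReductionGaugeBackground.exists_gauge_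
background_coarseCube` gives `(g, Ũ)` and every structural letter; SC at `Ũ` (`…uniform₀` on `B9Eq335SmallBondsData`'s data); `hMD`
(`norm_covDivL2K_le_of_transport`); the cube's site space over the collar set (a `Submodule` built in-proof); (β) at `Ũ` (`exists_window_hcmp`);
`hlocR ∕ hlocD ∕ hlocC` (`B9Eq387CubeProjectionLocality`); `hQ` (`B9Eq315QTorusLocality.norm_QtorusW_gauge_transfer`); then ne9-leaf-06's
`B9Eq387CubeReductionSmallField.cube_estimate_of_gauge_reduction` with every letter inhabited, and (W3). [folklore] (composition BY NAME)
[cite: Balaban1985BackgroundPropagators, (3.35) p.396, Cor 3.6 p.408, Thm 3.11 p.416, (3.87)–(3.89) p.409, (3.26) p.395, (3.28)–(3.33) pp.395–396; Balaban1985Averaging, pp.24–25] -/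
theorem cube_loc_closed (hL1 : 1 ≤ L) :
    ∃ γ ε₂ ε₁ κ C : ℝ, 0 < γ ∧ 0 < ε₂ ∧ 0 < ε₁ ∧ ε₁ ≤ 1 ∧ 0 < κ ∧ 0 ≤ C ∧
      3 ^ (d + 1) * ((1 + 2 * Mφ * Mφ' * ε₁) ^ ((d + 1) * (L - 1)) - 1) < 1 ∧
      ∀ (m : Fin (d + 1) → ℕ) [∀ i, NeZero (m i)] [∀ i, NeZero (fineP L m i)]
        (U : Bond (d + 1) (fineP L m) → 𝔸ˣ) (hU : ∀ b, U b ∈ U1 𝔸) (hUstar : ∀ b, star ((U b : 𝔸ˣ) : 𝔸) = (((U b)⁻¹ : 𝔸ˣ) : 𝔸))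
        {δ : ℝ} (hδ0 : 0 ≤ δ)
        (hδr : δ ≤ 1 / (64 * ((L : ℝ) * ((((d + 1 : ℕ) : ℝ) - 1) * ((L : ℝ) - 1)) + 1)))
        (hδ : ∀ p : B9SectCLatticeCarrier.Plaq (d + 1) (fineP L m), ‖(plaqHolU U p : 𝔸) - 1‖ ≤ δ)
        -- the cube: collar radii, extent, corner, support blocks
        (r₀ R : ℕ) (hr₀ : 0 < r₀) (hR : 0 < R) (Nc : B7Prop1Explicit.Site (d + 1)) (hNm : ∀ i, Nc i + 4 ≤ (m i : ℤ))
        (y₁ : TSite (d + 1) m) (Z₀ : Finset (TSite (d + 1) m))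
        (hZ₀ : ∀ z ∈ Z₀, ∀ i, ((r₀ + R : ℕ) : ℤ) + 1 ≤ liftSite (z - y₁) i ∧ liftSite (z - y₁) i + (r₀ + R : ℕ) ≤ Nc i + 1)
        -- the three scalar windows (HONEST residue: SC's window at `Ũ`, (K8-E)'s window, the collar number)
        (hw1 : (l1 (fun i => (L : ℤ) * (Nc i + 3)) : ℝ) * δ ≤ ε₂)
        (hw1' : (l1 (fun i => (L : ℤ) * (Nc i + 3)) : ℝ) * δ ≤ 1 / (256 * (((d + 1 : ℕ) : ℝ) + 1) ^ 2 * (L : ℝ) ^ ((d + 1) + 1)))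
        (hw2 : (l1 (fun i => (L : ℤ) * (Nc i + 3)) : ℝ) * δ ≤ ε₁)
        (hrad : 3 * (C * latticeConst (d + 1) (κ / 2) * Real.exp (-(κ / 2 * (r₀ : ℝ))) +
              Real.sqrt ((d + 1 : ℕ) : ℝ) * ((L : ℝ) / (R : ℝ) * (Mφ * Mφ' + 1)) * (Real.sqrt (1 / 8))⁻¹ +
              (((d + 1 : ℕ) : ℝ) * (2 * (L : ℝ) ^ 2 / (R : ℝ)) +
                ((1 - 3 ^ (d + 1) * ((1 + 2 * Mφ * Mφ' * ε₁) ^ ((d + 1) * (L - 1)) - 1))⁻¹ *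
                  ((d + 1 : ℕ) * (3 / 2 : ℝ) ^ (d + 1) * (9 * Real.pi ^ 2) * 2 ^ (d + 1 - 1) +
                    (d + 1 : ℕ) * 3 ^ (d + 1) * ((L : ℝ) ^ 2 * (Mφ' * Mφ * (2 * (2 * ((l1 (fun i => (L : ℤ) * (Nc i + 3)) : ℝ) * δ)) + 4 * ε₁ ^ 2))) +
                    (d + 1 : ℕ) * (3 / 2 : ℝ) ^ (d + 1) * (6 * Real.pi) * 2 ^ (d + 1 - 1) * ((L : ℝ) * (2 * Mφ * Mφ' * ε₁)))) *
                ((1 + 2 * Mφ * Mφ' * ε₁) ^ ((d + 1) * (L - 1)) * (((d + 1 : ℕ) : ℝ) * ((L : ℝ) / (R : ℝ))))) * ((Real.sqrt (1 / 8))⁻¹) ^ 2) *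
              (2 * Real.sqrt ((d + 1 : ℕ) : ℝ) * (‖((η : ℂ))⁻¹‖ * (1 + 1))) ^ 2 ≤ γ / 2)
        (hrad1 : (C * latticeConst (d + 1) (κ / 2) * Real.exp (-(κ / 2 * (r₀ : ℝ))) +
              Real.sqrt ((d + 1 : ℕ) : ℝ) * ((L : ℝ) / (R : ℝ) * (Mφ * Mφ' + 1)) * (Real.sqrt (1 / 8))⁻¹ +
              (((d + 1 : ℕ) : ℝ) * (2 * (L : ℝ) ^ 2 / (R : ℝ)) +
                ((1 - 3 ^ (d + 1) * ((1 + 2 * Mφ * Mφ' * ε₁) ^ ((d + 1) * (L - 1)) - 1))⁻¹ *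
                  ((d + 1 : ℕ) * (3 / 2 : ℝ) ^ (d + 1) * (9 * Real.pi ^ 2) * 2 ^ (d + 1 - 1) +
                    (d + 1 : ℕ) * 3 ^ (d + 1) * ((L : ℝ) ^ 2 * (Mφ' * Mφ * (2 * (2 * ((l1 (fun i => (L : ℤ) * (Nc i + 3)) : ℝ) * δ)) + 4 * ε₁ ^ 2))) +
                    (d + 1 : ℕ) * (3 / 2 : ℝ) ^ (d + 1) * (6 * Real.pi) * 2 ^ (d + 1 - 1) * ((L : ℝ) * (2 * Mφ * Mφ' * ε₁)))) *
                ((1 + 2 * Mφ * Mφ' * ε₁) ^ ((d + 1) * (L - 1)) * (((d + 1 : ℕ) : ℝ) * ((L : ℝ) / (R : ℝ))))) * ((Real.sqrt (1 / 8))⁻¹) ^ 2) ≤ 1)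
        -- the cube field
        (A : BondL2K ℂ (d + 1) (fineP L m) c₀ W)
        (hA : ∀ b : Bond (d + 1) (fineP L m), blockCoord L m (bpos b) ∉ Z₀ → WL2.equiv ℂ _ W A b = 0),
        (γ / 2) * ‖A‖ ^ 2 ≤
          ‖covCurlL2K ℂ c₀ ((η : ℂ))⁻¹ (adTransportW φ U) A‖ ^ 2 +
            ‖RofU L m φ η U (c₀ := c₀) (covDivL2K ℂ c₀ ((η : ℂ))⁻¹ (adTransportW φ fun b => (U b)⁻¹) A)‖ ^ 2 +
            ‖((Real.sqrt a : ℝ) : ℂ) • QtorusW L m hL1 φ U (alpha_le_64_of_le L (d := d + 1) hL1 (Nat.succ_pos d) hδr)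
                (perCfg_mem_U1 L m hU) (hreg_of_small_plaquettes_local' L m hU hδ hδ0) (c₁ := c₁) A‖ ^ 2 := by
  obtain ⟨γ, ε₂, hγ, hε₂, HSC⟩ :=
    exists_coercive_principal_of_small_field_uniform₀ (d := d + 1) L hL1 φ (c₀ := c₀) (c₁ := c₁) hη.ne' ha hMφ hMφ' hφ hφ'
  obtain ⟨ε₁, κ, C, hε₁, hε₁1, hκ, hC, hq, HE⟩ := exists_window_hcmp (d := d) L hL φ hφ hφ' hMφ hMφ' c₀ η hη c₁ hc hηL
  refine ⟨γ, ε₂, ε₁, κ, C, hγ, hε₂, hε₁, hε₁1, hκ, hC, hq, ?_⟩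
  intro m _ _ U hU hUstar δ hδ0 hδr hδ r₀ R hr₀ hR Nc hNm y₁ Z₀ hZ₀ hw1 hw1' hw2 hrad hrad1 A hA
  have hm : ∀ i, 1 ≤ m i := fun i => Nat.one_le_iff_ne_zero.mpr (NeZero.ne (m i))
  -- the smallness number of the auxiliary background
  have hEPS0 : 0 ≤ (l1 (fun i => (L : ℤ) * (Nc i + 3)) : ℝ) * δ := mul_nonneg (Nat.cast_nonneg _) hδ0
  -- the `1`-neighbourhood of the support blocks and the collar set
  set Y₀ : Finset (TSite (d + 1) m) := Finset.univ.filter fun y => ∃ z₀ ∈ Z₀, tdist m z₀ y ≤ 1 with hY₀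
  set S : Set (TSite (d + 1) m) := {y | ∃ y₀ ∈ Y₀, tdist m y₀ y < (r₀ : ℝ) + (R : ℝ)} with hS
  have hZY : ∀ z ∈ Z₀, z ∈ Y₀ := fun z hz => by
    rw [hY₀, Finset.mem_filter]; exact ⟨Finset.mem_univ _, z, hz, by rw [tdist_self]; norm_num⟩
  have hZS : ∀ z ∈ Z₀, z ∈ S := fun z hz =>
    ⟨z, hZY z hz, by rw [tdist_self]; exact_mod_cast Nat.add_pos_left hr₀ R⟩
  -- geometry: the collar set sits in the box `y₁ + [1, Nc + 1]`
  have hSbox : ∀ y ∈ S, ∀ i, 1 ≤ liftSite (y - y₁) i ∧ liftSite (y - y₁) i ≤ Nc i + 1 := by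
    intro y hy i
    obtain ⟨y₀, hy₀, hyy⟩ := hy
    rw [hY₀, Finset.mem_filter] at hy₀
    obtain ⟨z₀, hz₀, hzy₀⟩ := hy₀.2
    obtain ⟨k, hk⟩ : ∃ k : ℕ, tdist m y₀ y = k := ⟨_, rfl⟩
    have hk' : (k : ℝ) < r₀ + R := by rw [← hk]; exact hyy
    have hk'' : k + 1 ≤ r₀ + R := by exact_mod_cast hk'
    have hzy : tdist m z₀ y ≤ ((r₀ + R : ℕ) : ℝ) := by
      have htri := tdist_triangle hm z₀ y₀ y
      have : ((k + 1 : ℕ) : ℝ) ≤ ((r₀ + R : ℕ) : ℝ) := by exact_mod_cast hk''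
      push_cast at this ⊢
      linarith
    have hgeo : (((r₀ + R : ℕ) : ℤ) + 1) - (r₀ + R : ℕ) ≤ liftSite (y - y₁) i ∧
        liftSite (y - y₁) i ≤ (Nc i + 1 - ((r₀ + R : ℕ) : ℤ)) + (r₀ + R : ℕ) :=
      liftSite_sub_mem_of_tdist_le y₁ (lo := fun _ => ((r₀ + R : ℕ) : ℤ) + 1) (hi := fun i => Nc i + 1 - ((r₀ + R : ℕ) : ℤ))
        (r := r₀ + R) (fun _ => by push_cast; linarith) (fun i => by have := hNm i; push_cast; linarith)
        (↑Z₀ : Set (TSite (d + 1) m))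
        (fun z hz i => by obtain ⟨h1, h2⟩ := hZ₀ z (Finset.mem_coe.1 hz) i; exact ⟨h1, by linarith⟩) y ⟨z₀, Finset.mem_coe.2 hz₀, hzy⟩ i
    constructor <;> linarith [hgeo.1, hgeo.2]
  -- (K9) §6: the gauge and the auxiliary background with every letter
  have hδbox : ∀ (x : TSite (d + 1) (fineP L m)) (κ' μ : Fin (d + 1)) (hκμ : κ' < μ),
      liftSite (x - centre L m y₁) + e κ' + e μ ≤ (fun i => (L : ℤ) * (Nc i + 3)) → ‖(plaqHolU U (x, ⟨(κ', μ), hκμ⟩) : 𝔸) - 1‖ ≤ δ :=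
    fun x κ' μ hκμ _ => hδ _
  obtain ⟨g, Ũ, hg1, _hgstar, hŨ1, _hŨstar, hŨε, hŨ2, hagree, _hoff, hAd, hRSŨ, _hconŨ, hconŨinv⟩ :=
    exists_gauge_background_coarseCube L m φ hAdU hU hUstar y₁ hNm S hSbox hδ0 hδbox
  -- the agreement letter on the (smaller) neighbourhoods of `Z₀`
  have hagreeZ : ∀ b : Bond (d + 1) (fineP L m), (∃ z ∈ (↑Z₀ : Set (TSite (d + 1) m)), tdist m z (blockCoord L m (bpos b)) ≤ 1) →
      gaugeU g U b = Ũ b := fun b ⟨z, hz, hzb⟩ => hagree b ⟨z, hZS z (Finset.mem_coe.1 hz), hzb⟩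
  -- `Ũ`'s `Q`-data and SC at `Ũ`
  have hα1Ũ := alpha_le_64 (d := d + 1) hL1 hEPS0 hw1'
  have hU1Ũ := perCfg_mem_U1 L m hŨ1
  have hregŨ := hreg_of_small_bonds L m hŨ1 hEPS0 hŨε
  have hγŨ := HSC m Ũ hα1Ũ hU1Ũ hregŨ hEPS0 hw1 hŨε hRSŨ
  -- the divergence bound at `Ũ`
  have hMD : ∀ z : BondL2K ℂ (d + 1) (fineP L m) c₀ W,
      ‖covDivL2K ℂ c₀ ((η : ℂ))⁻¹ (adTransportW φ fun b => (Ũ b)⁻¹) z‖ ≤ 2 * Real.sqrt ((d + 1 : ℕ) : ℝ) * (‖((η : ℂ))⁻¹‖ * (1 + 1)) * ‖z‖ :=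
    fun z => norm_covDivL2K_le_of_transport (S := adTransportW φ fun b => (Ũ b)⁻¹) zero_le_one
      (fun b v => by rw [one_mul]; exact hconŨinv b v) _ z
  -- the cube's site space over the collar set
  let Nsp : Submodule ℂ (SiteL2K ℂ (d + 1) (fineP L m) c₀ W) :=
    { carrier := {f | ∀ x : TSite (d + 1) (fineP L m), blockCoord L m x ∉ S →
        WL2.equiv ℂ (fun _ : TSite (d + 1) (fineP L m) => c₀) W f x = 0}
      add_mem' := fun {f f'} hf hf' x hx => by
        show WL2.equiv ℂ (fun _ : TSite (d + 1) (fineP L m) => c₀) W (f + f') x = 0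
        rw [WL2.equiv_add, Pi.add_apply, hf x hx, hf' x hx, add_zero]
      zero_mem' := fun x _ => by
        show WL2.equiv ℂ (fun _ : TSite (d + 1) (fineP L m) => c₀) W 0 x = 0
        rw [WL2.equiv_zero, Pi.zero_apply]
      smul_mem' := fun c f hf x hx => by
        show WL2.equiv ℂ (fun _ : TSite (d + 1) (fineP L m) => c₀) W (c • f) x = 0
        rw [WL2.equiv_smul, Pi.smul_apply, hf x hx, smul_zero] }
  have hN : ∀ f : SiteL2K ℂ (d + 1) (fineP L m) c₀ W, f ∈ Nsp ↔
      ∀ x : TSite (d + 1) (fineP L m), blockCoord L m x ∉ S → WL2.equiv ℂ (fun _ : TSite (d + 1) (fineP L m) => c₀) W f x = 0 :=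
    fun f => Iff.rfl
  -- the gauged cube field and its support
  set Ag := gaugeW φ (fun b : Bond (d + 1) (fineP L m) => g (bpos b)) A with hAg
  have hAg0 : ∀ b : Bond (d + 1) (fineP L m), blockCoord L m (bpos b) ∉ Z₀ → WL2.equiv ℂ (fun _ : Bond (d + 1) (fineP L m) => c₀) W Ag b = 0 :=
    fun b hb => by rw [hAg, equiv_gaugeW_eq]; simp only [hA b hb, map_zero]
  have hAg0' : ∀ b : Bond (d + 1) (fineP L m), blockCoord L m (bpos b) ∉ (↑Z₀ : Set (TSite (d + 1) m)) →
      WL2.equiv ℂ (fun _ : Bond (d + 1) (fineP L m) => c₀) W Ag b = 0 := fun b hb => hAg0 b (fun h => hb (Finset.mem_coe.2 h))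
  -- the collinear letter and (β) at `Ũ`
  have hcol : ∀ (y : TSite (d + 1) (fineP L m)) (μ : Fin (d + 1)),
      ‖((Ũ (y, μ) : 𝔸ˣ) : 𝔸) - Ũ (unshift μ y, μ)‖ ≤ 2 * ((l1 (fun i => (L : ℤ) * (Nc i + 3)) : ℝ) * δ) := fun y μ => hŨ2 _ _
  have hŨε1 : ∀ b, ‖((Ũ b : 𝔸ˣ) : 𝔸) - 1‖ ≤ ε₁ := fun b => (hŨε b).trans hw2
  have hr₀' : (0 : ℝ) < r₀ := by exact_mod_cast hr₀
  have hR' : (0 : ℝ) < R := by exact_mod_cast hR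
  have hcmp := HE m Ũ hŨ1 hŨε1 hRSŨ (mul_nonneg (by norm_num) hEPS0) hcol Z₀ hY₀ hr₀' hR' hN Ag hAg0
  -- locality `U^g ↔ Ũ` from (K8) on the agreement letter
  have hlocR := cube_projR_congr_of_background L m φ η (c₁ := c₁) hm (gaugeU g U) Ũ S hagree hN _ _ rfl rfl
    ((WL2.linearEquiv ℂ ℂ (fun _ : TSite (d + 1) m => c₁)).symm.toLinearMap ∘ₗ QprimeW L m φ (gaugeU g U) (c₀ := c₀))
    ((WL2.linearEquiv ℂ ℂ (fun _ : TSite (d + 1) m => c₁)).symm.toLinearMap ∘ₗ QprimeW L m φ Ũ (c₀ := c₀)) rfl rfl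
  have hlocD : covDivL2K ℂ c₀ ((η : ℂ))⁻¹ (adTransportW φ fun b => (gaugeU g U b)⁻¹) Ag =
      covDivL2K ℂ c₀ ((η : ℂ))⁻¹ (adTransportW φ fun b => (Ũ b)⁻¹) Ag :=
    covDivL2K_congr ((η : ℂ))⁻¹ (fun b : Bond (d + 1) (fineP L m) => ∃ y ∈ S, tdist m y (blockCoord L m (bpos b)) ≤ 1)
      (fun b hb => adTransportW_inv_congr φ (hagree b hb)) Ag
      (fun b hb => hAg0 b fun hin => hb ⟨blockCoord L m (bpos b), hZS _ hin, by rw [tdist_self]; norm_num⟩)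
  have hlocC := covCurlL2K_congr_of_support L m hm ((η : ℂ))⁻¹ (↑Z₀ : Set (TSite (d + 1) m))
    (fun b hb => adTransportW_congr φ (hagreeZ b hb)) Ag hAg0'
  -- `U`'s and `U^g`'s `Q`-data; the transfer letter from (K8-Q)
  have hU1U := perCfg_mem_U1 L m hU
  have hregU := hreg_of_small_plaquettes_local' L m hU hδ hδ0
  have hα1U := alpha_le_64_of_le L (d := d + 1) hL1 (Nat.succ_pos d) hδr
  have hU1g : ∀ (x : B7Prop1Explicit.Site (d + 1)) (κ' : Fin (d + 1)), perCfg (fineP L m) (gaugeU g U) x κ' ∈ U1 𝔸 :=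
    fun x κ' => by rw [B9Eq315QTorus.perCfg_apply]; exact gaugeU_mem_U1 _ hU hg1 _
  have hregg := hreg_gaugeU L m g U hg1 hregU
  have hQ := norm_QtorusW_gauge_transfer L m hL1 φ (c₀ := c₀) (c₁ := c₁) U Ũ hα1U hα1Ũ hU1U hregU hU1g hregg hU1Ũ hregŨ hm hAd
    (↑Z₀ : Set (TSite (d + 1) m)) hagreeZ A (fun b hb => hA b fun h => hb (Finset.mem_coe.2 h)) a
  -- (β)'s window constant is non-negative (for INTENT-3's `0 ≤ ε`)
  have hrad0 : 0 ≤ (C * latticeConst (d + 1) (κ / 2) * Real.exp (-(κ / 2 * (r₀ : ℝ))) +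
              Real.sqrt ((d + 1 : ℕ) : ℝ) * ((L : ℝ) / (R : ℝ) * (Mφ * Mφ' + 1)) * (Real.sqrt (1 / 8))⁻¹ +
              (((d + 1 : ℕ) : ℝ) * (2 * (L : ℝ) ^ 2 / (R : ℝ)) +
                ((1 - 3 ^ (d + 1) * ((1 + 2 * Mφ * Mφ' * ε₁) ^ ((d + 1) * (L - 1)) - 1))⁻¹ *
                  ((d + 1 : ℕ) * (3 / 2 : ℝ) ^ (d + 1) * (9 * Real.pi ^ 2) * 2 ^ (d + 1 - 1) +
                    (d + 1 : ℕ) * 3 ^ (d + 1) * ((L : ℝ) ^ 2 * (Mφ' * Mφ * (2 * (2 * ((l1 (fun i => (L : ℤ) * (Nc i + 3)) : ℝ) * δ)) + 4 * ε₁ ^ 2))) +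
                    (d + 1 : ℕ) * (3 / 2 : ℝ) ^ (d + 1) * (6 * Real.pi) * 2 ^ (d + 1 - 1) * ((L : ℝ) * (2 * Mφ * Mφ' * ε₁)))) *
                ((1 + 2 * Mφ * Mφ' * ε₁) ^ ((d + 1) * (L - 1)) * (((d + 1 : ℕ) : ℝ) * ((L : ℝ) / (R : ℝ))))) * ((Real.sqrt (1 / 8))⁻¹) ^ 2) := by
    have hq' : 0 < 1 - 3 ^ (d + 1) * ((1 + 2 * Mφ * Mφ' * ε₁) ^ ((d + 1) * (L - 1)) - 1) := by linarith
    have hlc : 0 ≤ latticeConst (d + 1) (κ / 2) := B4Sect5Proof.latticeConst_nonneg (d + 1) (by positivity)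
    have hε₁0 : 0 ≤ ε₁ := hε₁.le
    generalize hP : (1 - 3 ^ (d + 1) * ((1 + 2 * Mφ * Mφ' * ε₁) ^ ((d + 1) * (L - 1)) - 1))⁻¹ = P at *
    have hP0 : 0 < P := by rw [← hP]; exact inv_pos.mpr hq'
    generalize hLC : latticeConst (d + 1) (κ / 2) = LC at *
    generalize hPE : (1 + 2 * Mφ * Mφ' * ε₁) ^ ((d + 1) * (L - 1)) = PE at *
    have hPE0 : 0 ≤ PE := by rw [← hPE]; positivity
    positivity
  -- the per-cube reduction (leaf-06 INTENT-3) with every letter inhabited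
  have hred := cube_estimate_of_gauge_reduction L m φ c₀ η U Ũ g hAd hRSŨ
    (QtorusW L m hL1 φ U hα1U hU1U hregU (c₁ := c₁)) (QtorusW L m hL1 φ Ũ hα1Ũ hU1Ũ hregŨ (c₁ := c₁)) ha.le hγŨ hMD
    _ rfl _ rfl _ rfl _ rfl _ rfl Nsp hrad0 hrad1 A hcmp hlocR hlocD hlocC hQ
  -- close: `γ − 3εM_D² ≥ γ/2`
  rw [zero_mul, zero_add] at hred
  exact le_trans (mul_le_mul_of_nonneg_right (by linarith) (sq_nonneg _)) hred

end Literature.MathematicalPhysics.QuantumFieldTheory.Balaban1983to89.B9Eq387CubeReductionClosed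

end
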